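import Literature.Computability.AlgebraicComplexity.CNFPermanent
import Literature.Computability.AlgebraicComplexity.ValiantAllAtOnce
import Literature.Computability.Complexity.CountingReductions
import HarnessLib

/-!
# Valiant's integer matrix of a 3-CNF in closed form: `per = 16^{3m} · #SAT` (Valiant 1979, Lemma 3.1)

Valiant 1979, Lemma 3.1 (*The complexity of computing the permanent*, TCS 8, p. 193): there is a
polynomial-time `f` from CNF formulae to `{-1,0,1,2,3}`-matrices with `Perm f(F) = 4^{t(F)} s(F)`.
The tree proves the mathematics in two layers — `CNFPermanent.lean` (the clause-product matrix
`cnfMatrix φ` over `ℤ ∪ Y`, `∑_e per cnfMatrix φ (Y := e) = #SAT φ`) and `ValiantAllAtOnce.lean`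
(`per (allAtOnce A) = 16^{#occ} · ∑_e per A (Y := e)`, the junctions of all variables at once) —
on structured index types. For the reduction MACHINE one needs the resulting integer matrix as an
explicit function of the formula's text. This file provides it for 3-CNFs (each clause exactly three
literals, the `#3SAT` of `CountingReductions.lean`):

* block structure of `cnfMatrix` (`bstart`, `cnfW_block`, `cnfW_cross`) and, for 3-CNFs, the
  closed form `ent3 φ r s` of its entries (`cnfMatrix_eq_ent3`): clause `j` occupies the indices
  `7j, …, 7j+6`, its literals sit at the diagonal positions `7j+1, 7j+3, 7j+5` (`dpos`), with the
  constants `s, p ∈ {-1, 0, 1}` of the literals next to them;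
* the occurrences of `cnfMatrix φ` are `o ↦ (dpos o, dpos o)`, `o < 3m` (`occOf`, a bijection),
  and the order predicates of `ValiantAllAtOnce.lean` become the index predicates `isFirst3`,
  `isLast3`, `isNext3` on `o < 3m` phrased with the VARIABLE NAMES only through equality tests;
* **`Valiant3CNF.M3 φ n₀ W`** — the closed-form integer matrix on
  `I3 n₀ W = Fin n₀ ⊕ (Fin W × (Fin 4 ⊕ Fin 4)) ⊕ Fin W` (`n₀ = 7m` original indices, `W = 3m`
  occurrence blocks `L_{o,·}, R_{o,·}`, and one control index PER OCCURRENCE, active when the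
  occurrence is the first of its variable and an isolated unit loop otherwise — so that no ranking
  of the variables is needed), defined for CNFs over any variable type and invariant under injective
  renaming (`M3_renameCNF`);
* `permanent_M3_fin` — for a 3-CNF `φ` over `Fin t` in which every variable occurs,
  `per (M3 φ (cnfDim φ) (3m)) = 16^{3m} · #{e | e ⊨ φ}` (re-index to
  `allAtOnce (cnfMatrix φ) ⊕ 1`, then `perY_allAtOnce` and `entryPer_boolSubst_cnfMatrix`);
* `permanent_M3` — for a 3-CNF `ψ` over `ℕ` (renamed along `ψ.vars ≃ Fin t`, `finCNF`,
  `card_sat_finCNF`), `per (M3 ψ (7m) (3m)) = 16^{3m} · numSat ψ` with the tree's `CNF.numSat`.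
  (Valiant's constant is `4^{t(F)}`, `t(F)` = twice the number of literal occurrences minus the
  number of clauses; here it is `16^{3m}` because each occurrence carries a PAIR of BCS junction
  blocks, `4 · 4`, and the clause blocks are path-DAGs contributing no constant.)

## References

* L. G. Valiant, *The complexity of computing the permanent*, Theoret. Comput. Sci. 8 (1979)
  189–201, Lemma 3.1 (p. 193) and its proof (pp. 194–196).
* P. Bürgisser, M. Clausen, M. A. Shokrollahi, *Algebraic Complexity Theory*, Springer 1997,
  Thm. (21.29) (pp. 558–563).
-/

noncomputable section

open MvPolynomial Matrix Finset

namespace Literature.Computability.AlgebraicComplexity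

open Literature.Computability.Complexity CNFPer ValiantAll

namespace Valiant3CNF

universe u v

variable {k : Type u} [CommRing k] {σ : Type v} {t : ℕ}

/-! ### Block structure of `cnfW` -/

section Blocks

/-- The first DAG node of clause `j`: `∑_{j' < j} (2 w_{j'} + 1)`. [cite: Valiant1979, Lemma 3.1] -/
def bstart {ν : Type*} (φ : CNF ν) (j : ℕ) : ℕ := cnfDim (φ.take j)

/-- `bstart φ 0 = 0`. [folklore] -/
@[simp] theorem bstart_zero {ν : Type*} (φ : CNF ν) : bstart φ 0 = 0 := by simp [bstart]

/-- `bstart (c :: cs) (j+1) = (2|c|+1) + bstart cs j`. [folklore] -/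
@[simp] theorem bstart_cons_succ {ν : Type*} (c : Clause ν) (cs : CNF ν) (j : ℕ) :
    bstart (c :: cs) (j + 1) = 2 * c.length + 1 + bstart cs j := by
  simp [bstart]

/-- **Inside a block, `cnfW` is the clause DAG of that block.** [cite: Valiant1979, Lemma 3.1] -/
theorem cnfW_block : ∀ (φ : CNF (Fin t)) (j : ℕ) (hj : j < φ.length) (a b : ℕ),
    bstart φ j ≤ a → bstart φ j < b → b ≤ bstart φ j + (2 * (φ[j]).length + 1) →
    cnfW (k := k) (σ := σ) φ a b = clauseW (φ[j]) (a - bstart φ j) (b - bstart φ j)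
  | [], j, hj, _, _, _, _, _ => by simp at hj
  | c :: cs, 0, _, a, b, _, _, hb => by
    simp only [bstart_zero, List.getElem_cons_zero, Nat.zero_add, Nat.sub_zero] at hb ⊢
    simp [cnfW, seriesW, hb]
  | c :: cs, j + 1, hj, a, b, ha, hab, hb => by
    have hj' : j < cs.length := by simpa using hj
    simp only [bstart_cons_succ, List.getElem_cons_succ] at ha hab hb ⊢
    have h1 : ¬ b ≤ 2 * c.length + 1 := by omega
    have h2 : 2 * c.length + 1 ≤ a := by omega
    rw [cnfW, seriesW]
    simp only [h1, if_false, h2, if_true]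
    rw [cnfW_block cs j hj' (a - (2 * c.length + 1)) (b - (2 * c.length + 1)) (by omega) (by omega) (by omega)]
    congr 1 <;> omega

/-- **Across blocks, `cnfW` vanishes**: a source before block `j` has no edge into block `j`. [cite: Valiant1979, Lemma 3.1] -/
theorem cnfW_cross : ∀ (φ : CNF (Fin t)) (j : ℕ) (hj : j < φ.length) (a b : ℕ),
    a < bstart φ j → bstart φ j < b → b ≤ bstart φ j + (2 * (φ[j]).length + 1) →
    cnfW (k := k) (σ := σ) φ a b = Sum.inl 0
  | [], j, hj, _, _, _, _, _ => by simp at hj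
  | c :: cs, 0, _, a, b, ha, _, _ => by simp at ha
  | c :: cs, j + 1, hj, a, b, ha, hab, hb => by
    have hj' : j < cs.length := by simpa using hj
    simp only [bstart_cons_succ, List.getElem_cons_succ] at ha hab hb
    have h1 : ¬ b ≤ 2 * c.length + 1 := by omega
    rw [cnfW, seriesW]
    simp only [h1, if_false]
    split_ifs with h2
    · exact cnfW_cross cs j hj' _ _ (by omega) (by omega) (by omega)
    · rfl

/-- In a 3-CNF the blocks start at the multiples of `7`. [cite: Valiant1979, Lemma 3.1] -/
theorem bstart_eq {ν : Type*} (φ : CNF ν) (hw : CNF.IsWidthEq 3 φ) :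
    ∀ j, j ≤ φ.length → bstart φ j = 7 * j := by
  induction φ with
  | nil => intro j hj; simp at hj; subst hj; simp
  | cons c cs ih =>
    intro j hj
    cases j with
    | zero => simp
    | succ j =>
      rw [bstart_cons_succ, hw c (by simp), ih (fun c' hc' => hw c' (by simp [hc'])) j (by simpa using hj)]
      ring

/-- In a 3-CNF with `m` clauses the matrix has size `7m`. [cite: Valiant1979, Lemma 3.1] -/
theorem cnfDim_eq {ν : Type*} (φ : CNF ν) (hw : CNF.IsWidthEq 3 φ) : cnfDim φ = 7 * φ.length := by
  have := bstart_eq φ hw φ.length le_rfl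
  rwa [bstart, List.take_length] at this

end Blocks

/-! ### The closed form of `cnfMatrix` for 3-CNFs -/

section ClosedForm

/-- The local table of a width-3 clause block: weights `w(a, b)` of the clause DAG on `{0,…,7}`
(`b = 7`: the bypass `1` from `0` and the `-1` from `6`; `b ∈ {2i+1, 2i+2}`: the literal DAG of
literal `i`). [cite: Valiant1979, Lemma 3.1] -/
def locW (ls : List (Literal (Fin t))) (a b : ℕ) : k ⊕ (σ ⊕ Fin t) :=
  if b = 7 then Sum.inl ((if a = 0 then 1 else 0) + (if a = 6 then -1 else 0)) else
  match ls[(b - 1) / 2]? with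
  | none => Sum.inl 0
  | some l =>
    if a = 2 * ((b - 1) / 2) ∧ b = 2 * ((b - 1) / 2) + 1 then Sum.inl (litS l)
    else if a = 2 * ((b - 1) / 2) ∧ b = 2 * ((b - 1) / 2) + 2 then Sum.inl (litP l)
    else if a = 2 * ((b - 1) / 2) + 1 ∧ b = 2 * ((b - 1) / 2) + 2 then Sum.inr (Sum.inr l.1)
    else Sum.inl 0

/-- The clause DAG of a width-3 clause is the local table. [cite: Valiant1979, Lemma 3.1] -/
theorem clauseW_eq_locW (ls : List (Literal (Fin t))) (h : ls.length = 3) (a b : ℕ) (hab : a < b)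
    (hb : b ≤ 7) : clauseW (k := k) (σ := σ) ls a b = locW ls a b := by
  obtain ⟨l₀, l₁, l₂, rfl⟩ := List.length_eq_three.1 h
  interval_cases b <;> interval_cases a <;> simp [clauseW, litChainW, seriesW, litW, locW]

/-- **Closed form of the entries of `cnfMatrix φ` for a 3-CNF**: indices `r, s` (natural numbers),
clause `j = s / 7` of the column, local coordinates `a = r - 7j`, `b = s + 1 - 7j`. [cite: Valiant1979, Lemma 3.1] -/
def ent3 (φ : CNF (Fin t)) (r s : ℕ) : k ⊕ (σ ⊕ Fin t) :=
  if r = s + 1 then Sum.inl 1 else if s < r then Sum.inl 0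
  else if r < 7 * (s / 7) then Sum.inl 0
  else locW (φ.getD (s / 7) []) (r - 7 * (s / 7)) (s + 1 - 7 * (s / 7))

/-- `cnfMatrix φ = ent3 φ` on a 3-CNF. [cite: Valiant1979, Lemma 3.1] -/
theorem cnfMatrix_eq_ent3 (φ : CNF (Fin t)) (hw : CNF.IsWidthEq 3 φ) (r s : Fin (cnfDim φ)) :
    cnfMatrix (k := k) (σ := σ) φ r s = ent3 φ r.val s.val := by
  have hm := cnfDim_eq φ hw
  simp only [cnfMatrix, symHess, ent3]
  by_cases h1 : r.val = s.val + 1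
  · simp [h1]
  rw [if_neg h1, if_neg h1]
  by_cases h2 : s.val < r.val
  · rw [if_neg (by omega), if_pos h2]
  rw [if_pos (by omega), if_neg h2]
  have hs := s.isLt
  have hj : s.val / 7 < φ.length := by omega
  have hbs : bstart φ (s.val / 7) = 7 * (s.val / 7) := bstart_eq φ hw _ hj.le
  have hlen : (φ[s.val / 7]).length = 3 := hw _ (List.getElem_mem hj)
  by_cases h3 : r.val < 7 * (s.val / 7)
  · rw [if_pos h3]
    exact cnfW_cross φ (s.val / 7) hj r.val (s.val + 1) (by omega) (by omega) (by omega)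
  · rw [if_neg h3, cnfW_block φ (s.val / 7) hj r.val (s.val + 1) (by omega) (by omega) (by omega), hbs,
      List.getD_eq_getElem _ _ hj]
    exact clauseW_eq_locW _ hlen _ _ (by omega) (by omega)

/-- The diagonal position of occurrence `o = 3j + i`: `7j + 2i + 1`. [cite: Valiant1979, Lemma 3.1] -/
def dpos (o : ℕ) : ℕ := 7 * (o / 3) + 2 * (o % 3) + 1

/-- `dpos` is strictly monotone. [folklore] -/
theorem dpos_lt_dpos_iff (o o' : ℕ) : dpos o < dpos o' ↔ o < o' := by
  unfold dpos; omega

/-- `dpos` is monotone. [folklore] -/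
theorem dpos_le_dpos_iff (o o' : ℕ) : dpos o ≤ dpos o' ↔ o ≤ o' := by
  unfold dpos; omega

/-- `dpos` is injective. [folklore] -/
theorem dpos_inj {o o' : ℕ} (h : dpos o = dpos o') : o = o' := by
  unfold dpos at h; omega

/-- `dpos o < 7m` for `o < 3m`. [folklore] -/
theorem dpos_lt {m o : ℕ} (ho : o < 3 * m) : dpos o < 7 * m := by
  unfold dpos; omega

/-- The occurrence index of a diagonal position: `3 (s/7) + (s mod 7)/2`. [folklore] -/
def opos (s : ℕ) : ℕ := 3 * (s / 7) + s % 7 / 2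

/-- `opos ∘ dpos = id`. [folklore] -/
@[simp] theorem opos_dpos (o : ℕ) : opos (dpos o) = o := by
  unfold opos dpos; omega

/-- `dpos ∘ opos = id` on odd local positions. [folklore] -/
theorem dpos_opos {s : ℕ} (h : s % 7 % 2 = 1) : dpos (opos s) = s := by
  unfold opos dpos; omega

/-- The literal of occurrence `o`, if any: clause `o / 3`, position `o mod 3`. [cite: Valiant1979, Lemma 3.1] -/
def lit? {ν : Type*} (φ : CNF ν) (o : ℕ) : Option (Literal ν) :=
  (φ[o / 3]?).bind fun c => c[o % 3]?

/-- The variable of occurrence `o`, if any. [cite: Valiant1979, Lemma 3.1] -/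
def var? {ν : Type*} (φ : CNF ν) (o : ℕ) : Option ν := (lit? φ o).map Prod.fst

/-- The literal of occurrence `o < 3m` of a 3-CNF. [cite: Valiant1979, Lemma 3.1] -/
def lit3 {ν : Type*} (φ : CNF ν) (hw : CNF.IsWidthEq 3 φ) (o : Fin (3 * φ.length)) : Literal ν :=
  (φ[o.val / 3]'(by have := o.isLt; omega))[o.val % 3]'(by
    rw [hw _ (List.getElem_mem _)]; exact Nat.mod_lt _ (by norm_num))

/-- `lit? = some lit3` in range. [cite: Valiant1979, Lemma 3.1] -/
theorem lit?_eq {ν : Type*} (φ : CNF ν) (hw : CNF.IsWidthEq 3 φ) (o : Fin (3 * φ.length)) :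
    lit? φ o.val = some (lit3 φ hw o) := by
  have hj : o.val / 3 < φ.length := by have := o.isLt; omega
  have hi : o.val % 3 < (φ[o.val / 3]).length := by
    rw [hw _ (List.getElem_mem _)]; exact Nat.mod_lt _ (by norm_num)
  simp [lit?, lit3, List.getElem?_eq_getElem hj, List.getElem?_eq_getElem hi]

/-- `var? = some (lit3 ·).1` in range. [cite: Valiant1979, Lemma 3.1] -/
theorem var?_eq {ν : Type*} (φ : CNF ν) (hw : CNF.IsWidthEq 3 φ) (o : Fin (3 * φ.length)) :
    var? φ o.val = some (lit3 φ hw o).1 := by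
  rw [var?, lit?_eq φ hw o]; rfl

/-- In range, equality of `var?` is equality of the variables. [folklore] -/
theorem var?_eq_var?_iff {ν : Type*} (φ : CNF ν) (hw : CNF.IsWidthEq 3 φ) (o o' : Fin (3 * φ.length)) :
    var? φ o.val = var? φ o'.val ↔ (lit3 φ hw o).1 = (lit3 φ hw o').1 := by
  rw [var?_eq φ hw, var?_eq φ hw, Option.some_inj]

/-- **The diagonal entries at the occurrence positions are the variables.** [cite: Valiant1979, Lemma 3.1] -/
theorem ent3_dpos (φ : CNF (Fin t)) (hw : CNF.IsWidthEq 3 φ) (o : Fin (3 * φ.length)) :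
    ent3 (k := k) (σ := σ) φ (dpos o.val) (dpos o.val) = Sum.inr (Sum.inr (lit3 φ hw o).1) := by
  have ho := o.isLt
  have hj : o.val / 3 < φ.length := by omega
  have h7 : dpos o.val / 7 = o.val / 3 := by unfold dpos; omega
  have hi : o.val % 3 < (φ[o.val / 3]).length := by
    rw [hw _ (List.getElem_mem _)]; exact Nat.mod_lt _ (by norm_num)
  simp only [ent3, Nat.ne_of_lt (Nat.lt_succ_self _), if_false, lt_irrefl, h7]
  rw [if_neg (by unfold dpos; omega), List.getD_eq_getElem _ _ hj, locW]
  have hb : dpos o.val + 1 - 7 * (o.val / 3) = 2 * (o.val % 3) + 2 := by unfold dpos; omega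
  have ha : dpos o.val - 7 * (o.val / 3) = 2 * (o.val % 3) + 1 := by unfold dpos; omega
  rw [hb, ha, if_neg (by omega)]
  have hidx : (2 * (o.val % 3) + 2 - 1) / 2 = o.val % 3 := by omega
  rw [hidx, List.getElem?_eq_getElem hi]
  dsimp only
  rw [if_neg (by omega), if_neg (by omega), if_pos (by omega)]
  rfl

/-- **Where the variables are**: a variable entry of `ent3` sits on the diagonal at an odd local
position, and is the variable of the corresponding occurrence. [cite: Valiant1979, Lemma 3.1] -/
theorem ent3_eq_Y (φ : CNF (Fin t)) (hw : CNF.IsWidthEq 3 φ) {r s : ℕ} (hs : s < 7 * φ.length)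
    {v : Fin t} (h : ent3 (k := k) (σ := σ) φ r s = Sum.inr (Sum.inr v)) :
    r = s ∧ s % 7 % 2 = 1 ∧ ∃ ho : opos s < 3 * φ.length, (lit3 φ hw ⟨opos s, ho⟩).1 = v := by
  have hj : s / 7 < φ.length := by omega
  have hlen : (φ[s / 7]).length = 3 := hw _ (List.getElem_mem hj)
  unfold ent3 at h
  by_cases h1 : r = s + 1
  · rw [if_pos h1] at h; simp at h
  rw [if_neg h1] at h
  by_cases h2 : s < r
  · rw [if_pos h2] at h; simp at h
  rw [if_neg h2] at h
  by_cases h3 : r < 7 * (s / 7)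
  · rw [if_pos h3] at h; simp at h
  rw [if_neg h3, List.getD_eq_getElem _ _ hj] at h
  unfold locW at h
  by_cases h4 : s + 1 - 7 * (s / 7) = 7
  · rw [if_pos h4] at h; simp at h
  rw [if_neg h4] at h
  have hi3 : (s + 1 - 7 * (s / 7) - 1) / 2 < 3 := by omega
  rw [List.getElem?_eq_getElem (by rw [hlen]; exact hi3)] at h
  dsimp only at h
  by_cases h5 : r - 7 * (s / 7) = 2 * ((s + 1 - 7 * (s / 7) - 1) / 2) ∧
      s + 1 - 7 * (s / 7) = 2 * ((s + 1 - 7 * (s / 7) - 1) / 2) + 1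
  · rw [if_pos h5] at h; simp at h
  rw [if_neg h5] at h
  by_cases h6 : r - 7 * (s / 7) = 2 * ((s + 1 - 7 * (s / 7) - 1) / 2) ∧
      s + 1 - 7 * (s / 7) = 2 * ((s + 1 - 7 * (s / 7) - 1) / 2) + 2
  · rw [if_pos h6] at h; simp at h
  rw [if_neg h6] at h
  by_cases h7 : r - 7 * (s / 7) = 2 * ((s + 1 - 7 * (s / 7) - 1) / 2) + 1 ∧
      s + 1 - 7 * (s / 7) = 2 * ((s + 1 - 7 * (s / 7) - 1) / 2) + 2
  swap
  · rw [if_neg h7] at h; simp at h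
  rw [if_pos h7] at h
  have hv : ((φ[s / 7])[(s + 1 - 7 * (s / 7) - 1) / 2]).1 = v := by simpa using h
  have hodd : s % 7 % 2 = 1 := by omega
  have hi1 : opos s / 3 = s / 7 := by unfold opos; omega
  have hi2 : opos s % 3 = (s + 1 - 7 * (s / 7) - 1) / 2 := by unfold opos; omega
  have ho : opos s < 3 * φ.length := by unfold opos; omega
  have key : some (lit3 φ hw ⟨opos s, ho⟩) = some ((φ[s / 7])[(s + 1 - 7 * (s / 7) - 1) / 2]) := by
    rw [← lit?_eq φ hw ⟨opos s, ho⟩]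
    show ((φ[opos s / 3]?).bind fun c => c[opos s % 3]?) = _
    rw [hi1, hi2, List.getElem?_eq_getElem hj, Option.bind_some, List.getElem?_eq_getElem]
  refine ⟨by omega, hodd, ⟨ho, ?_⟩⟩
  rw [Option.some_inj.1 key]
  exact hv

end ClosedForm

/-! ### The occurrences of a 3-CNF matrix -/

section Occs

variable (φ : CNF (Fin t))

/-- The diagonal position of occurrence `o`, as an index of `cnfMatrix φ`. [cite: Valiant1979, Lemma 3.1] -/
def dposFin (hw : CNF.IsWidthEq 3 φ) (o : Fin (3 * φ.length)) : Fin (cnfDim φ) :=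
  ⟨dpos o.val, by rw [cnfDim_eq φ hw]; exact dpos_lt o.isLt⟩

/-- The entry of `cnfMatrix φ` at `(dpos o, dpos o)` is the variable of occurrence `o`. [cite: Valiant1979, Lemma 3.1] -/
theorem cnfMatrix_dpos (hw : CNF.IsWidthEq 3 φ) (o : Fin (3 * φ.length)) :
    cnfMatrix (k := k) (σ := σ) φ (dposFin φ hw o) (dposFin φ hw o) = Sum.inr (Sum.inr (lit3 φ hw o).1) := by
  rw [cnfMatrix_eq_ent3 φ hw]
  exact ent3_dpos φ hw o

/-- **The occurrence `o` of the 3-CNF matrix.** [cite: Valiant1979, Lemma 3.1] -/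
def occOf (hw : CNF.IsWidthEq 3 φ) (o : Fin (3 * φ.length)) : Occ (cnfMatrix (k := k) (σ := σ) φ) :=
  Occ.mk' _ (dposFin φ hw o) (dposFin φ hw o) (lit3 φ hw o).1 (cnfMatrix_dpos φ hw o)

/-- The variable of `occOf o` is the variable of literal `o`. [cite: Valiant1979, Lemma 3.1] -/
@[simp] theorem occOf_var (hw : CNF.IsWidthEq 3 φ) (o : Fin (3 * φ.length)) : (occOf (k := k) (σ := σ) φ hw o).var = (lit3 φ hw o).1 :=
  Occ.var_mk' _ _ _ _ _

/-- The column of `occOf o` is `dpos o`. [cite: Valiant1979, Lemma 3.1] -/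
@[simp] theorem occOf_snd_val (hw : CNF.IsWidthEq 3 φ) (o : Fin (3 * φ.length)) : ((occOf (k := k) (σ := σ) φ hw o).1.2).val = dpos o.val := rfl

/-- The row of `occOf o` is `dpos o`. [cite: Valiant1979, Lemma 3.1] -/
@[simp] theorem occOf_fst_val (hw : CNF.IsWidthEq 3 φ) (o : Fin (3 * φ.length)) : ((occOf (k := k) (σ := σ) φ hw o).1.1).val = dpos o.val := rfl

/-- `occOf` is injective, as an iff. [cite: Valiant1979, Lemma 3.1] -/
theorem occOf_eq_iff (hw : CNF.IsWidthEq 3 φ) (o o' : Fin (3 * φ.length)) : occOf (k := k) (σ := σ) φ hw o = occOf φ hw o' ↔ o = o' := by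
  constructor
  · intro h
    have := congrArg (fun õ : Occ (cnfMatrix (k := k) (σ := σ) φ) => õ.1.2.val) h
    simp only [occOf_snd_val] at this
    exact Fin.ext (dpos_inj this)
  · rintro rfl; rfl

/-- **Every occurrence of the 3-CNF matrix is some `occOf o`.** [cite: Valiant1979, Lemma 3.1] -/
theorem exists_occOf (hw : CNF.IsWidthEq 3 φ) (õ : Occ (cnfMatrix (k := k) (σ := σ) φ)) : ∃ o, occOf φ hw o = õ := by
  have hs : õ.1.2.val < 7 * φ.length := by rw [← cnfDim_eq φ hw]; exact õ.1.2.isLt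
  have h := õ.entry
  rw [cnfMatrix_eq_ent3 φ hw] at h
  obtain ⟨hrs, hodd, ho, hv⟩ := ent3_eq_Y φ hw hs h
  refine ⟨⟨opos õ.1.2.val, ho⟩, Occ.eq_of_col_eq _ (hasColumnProperty_cnfMatrix φ) (Fin.ext ?_)⟩
  show dpos (opos õ.1.2.val) = õ.1.2.val
  exact dpos_opos hodd

/-- Column order of occurrences is the order of their indices (strict). [cite: Valiant1979, Lemma 3.1] -/
theorem occOf_snd_lt_iff (hw : CNF.IsWidthEq 3 φ) (o o' : Fin (3 * φ.length)) :
    (occOf (k := k) (σ := σ) φ hw o).1.2 < (occOf (k := k) (σ := σ) φ hw o').1.2 ↔ o < o' := by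
  rw [Fin.lt_def, occOf_snd_val, occOf_snd_val, dpos_lt_dpos_iff, Fin.lt_def]

/-- Column order of occurrences is the order of their indices. [cite: Valiant1979, Lemma 3.1] -/
theorem occOf_snd_le_iff (hw : CNF.IsWidthEq 3 φ) (o o' : Fin (3 * φ.length)) :
    (occOf (k := k) (σ := σ) φ hw o).1.2 ≤ (occOf (k := k) (σ := σ) φ hw o').1.2 ↔ o ≤ o' := by
  rw [Fin.le_def, occOf_snd_val, occOf_snd_val, dpos_le_dpos_iff, Fin.le_def]

/-- Every occurrence of `cnfMatrix φ` is counted: `#Occ = 3m`. [cite: Valiant1979, Lemma 3.1] -/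
theorem card_occ_cnfMatrix (hw : CNF.IsWidthEq 3 φ) : Fintype.card (Occ (cnfMatrix (k := k) (σ := σ) φ)) = 3 * φ.length := by
  rw [← Fintype.card_fin (3 * φ.length)]
  exact (Fintype.card_congr (Equiv.ofBijective (occOf (k := k) (σ := σ) φ hw)
    ⟨fun o o' h => (occOf_eq_iff φ hw o o').1 h, exists_occOf φ hw⟩)).symm

end Occs

/-! ### The index predicates -/

section Preds

variable {ν : Type*} [DecidableEq ν]

/-- `o` is the first occurrence of its variable: no earlier occurrence has the same variable. [cite: Valiant1979, Lemma 3.1] -/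
def isFirst3 (φ : CNF ν) (o : ℕ) : Prop := ∀ o' < o, var? φ o' ≠ var? φ o

/-- `o` is the last occurrence of its variable among `o' < W`. [cite: Valiant1979, Lemma 3.1] -/
def isLast3 (φ : CNF ν) (W o : ℕ) : Prop := ∀ o' < W, o < o' → var? φ o' ≠ var? φ o

/-- `o'` is the next occurrence of the variable of `o`. [cite: Valiant1979, Lemma 3.1] -/
def isNext3 (φ : CNF ν) (o o' : ℕ) : Prop :=
  var? φ o' = var? φ o ∧ o < o' ∧ ∀ o'' < o', o < o'' → var? φ o'' ≠ var? φ o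

/-- `isFirst3` is decidable (bounded quantifier). [folklore] -/
instance (φ : CNF ν) (o : ℕ) : Decidable (isFirst3 φ o) := by unfold isFirst3; infer_instance
/-- `isLast3` is decidable (bounded quantifier). [folklore] -/
instance (φ : CNF ν) (W o : ℕ) : Decidable (isLast3 φ W o) := by unfold isLast3; infer_instance
/-- `isNext3` is decidable (bounded quantifier). [folklore] -/
instance (φ : CNF ν) (o o' : ℕ) : Decidable (isNext3 φ o o') := by unfold isNext3; infer_instance

variable (φ : CNF (Fin t))

/-- `IsFirst` of `occOf o` is `isFirst3 o`. [cite: Valiant1979, Lemma 3.1] -/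
theorem isFirst_occOf_iff (hw : CNF.IsWidthEq 3 φ) (o : Fin (3 * φ.length)) :
    IsFirst _ (occOf (k := k) (σ := σ) φ hw o) ↔ isFirst3 φ o.val := by
  unfold IsFirst isFirst3
  constructor
  · intro H o' ho' hv
    have ho'3 : o' < 3 * φ.length := lt_trans ho' o.isLt
    have h1 := H (occOf φ hw ⟨o', ho'3⟩) (by
      rw [occOf_var, occOf_var]; exact ((var?_eq_var?_iff φ hw ⟨o', ho'3⟩ o).1 hv))
    rw [occOf_snd_le_iff, Fin.le_def] at h1
    simp only at h1
    omega
  · intro H õ hv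
    obtain ⟨o', rfl⟩ := exists_occOf φ hw õ
    simp only [occOf_var] at hv
    rw [occOf_snd_le_iff]
    by_contra hlt
    exact H o'.val (by rw [Fin.not_le, Fin.lt_def] at hlt; exact hlt) ((var?_eq_var?_iff φ hw o' o).2 hv)

/-- `IsLast` of `occOf o` is `isLast3 o`. [cite: Valiant1979, Lemma 3.1] -/
theorem isLast_occOf_iff (hw : CNF.IsWidthEq 3 φ) (o : Fin (3 * φ.length)) :
    IsLast _ (occOf (k := k) (σ := σ) φ hw o) ↔ isLast3 φ (3 * φ.length) o.val := by
  unfold IsLast isLast3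
  constructor
  · intro H o' ho'3 ho' hv
    have h1 := H (occOf φ hw ⟨o', ho'3⟩) (by
      rw [occOf_var, occOf_var]; exact ((var?_eq_var?_iff φ hw ⟨o', ho'3⟩ o).1 hv))
    rw [occOf_snd_le_iff, Fin.le_def] at h1
    simp only at h1
    omega
  · intro H õ hv
    obtain ⟨o', rfl⟩ := exists_occOf φ hw õ
    simp only [occOf_var] at hv
    rw [occOf_snd_le_iff]
    by_contra hlt
    exact H o'.val o'.isLt (by rw [Fin.not_le, Fin.lt_def] at hlt; exact hlt)
      ((var?_eq_var?_iff φ hw o' o).2 hv)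

/-- `IsNext` of `occOf o, occOf o'` is `isNext3 o o'`. [cite: Valiant1979, Lemma 3.1] -/
theorem isNext_occOf_iff (hw : CNF.IsWidthEq 3 φ) (o o' : Fin (3 * φ.length)) :
    IsNext _ (occOf (k := k) (σ := σ) φ hw o) (occOf (k := k) (σ := σ) φ hw o') ↔ isNext3 φ o.val o'.val := by
  unfold IsNext isNext3
  rw [occOf_var, occOf_var, ← var?_eq_var?_iff φ hw, occOf_snd_lt_iff, Fin.lt_def]
  refine and_congr_right fun _ => and_congr_right fun hoo' => ⟨fun H o'' ho'' hlt hv => ?_, fun H õ hv hlt => ?_⟩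
  · have ho''3 : o'' < 3 * φ.length := lt_trans ho'' o'.isLt
    have h1 := H (occOf φ hw ⟨o'', ho''3⟩) (by
      rw [occOf_var]; exact ((var?_eq_var?_iff φ hw ⟨o'', ho''3⟩ o).1 hv))
      (by rw [occOf_snd_lt_iff, Fin.lt_def]; exact hlt)
    rw [occOf_snd_le_iff, Fin.le_def] at h1
    simp only at h1
    omega
  · obtain ⟨o'', rfl⟩ := exists_occOf φ hw õ
    simp only [occOf_var] at hv
    rw [occOf_snd_lt_iff, Fin.lt_def] at hlt
    rw [occOf_snd_le_iff]
    by_contra hle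
    exact H o''.val (by rw [Fin.not_le, Fin.lt_def] at hle; exact hle) hlt ((var?_eq_var?_iff φ hw o'' o).2 hv)

end Preds

/-! ### The closed-form integer matrix `M3` -/

section M3Def

variable {ν : Type*}

/-- The index type of the machine layout: `n₀` original indices, `8` per occurrence, one control
slot per occurrence. [cite: Valiant1979, Lemma 3.1] -/
abbrev I3 (n₀ W : ℕ) : Type := Fin n₀ ⊕ ((Fin W × (Fin 4 ⊕ Fin 4)) ⊕ Fin W)

/-- The integer `p` of a literal. [cite: Valiant1979, Lemma 3.1] -/
def litPZ (l : Literal ν) : ℤ := if l.2 then 1 else 0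

/-- The integer `s` of a literal. [cite: Valiant1979, Lemma 3.1] -/
def litSZ (l : Literal ν) : ℤ := if l.2 then -1 else 1

/-- The integer local table of a clause block with all `Y := 0`. [cite: Valiant1979, Lemma 3.1] -/
def locZ (ls : List (Literal ν)) (a b : ℕ) : ℤ :=
  if b = 7 then (if a = 0 then 1 else 0) + (if a = 6 then -1 else 0) else
  match ls[(b - 1) / 2]? with
  | none => 0
  | some l =>
    if a = 2 * ((b - 1) / 2) ∧ b = 2 * ((b - 1) / 2) + 1 then litSZ l
    else if a = 2 * ((b - 1) / 2) ∧ b = 2 * ((b - 1) / 2) + 2 then litPZ l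
    else 0

/-- The integer closed form of the original block (`cnfMatrix` with all `Y := 0`). [cite: Valiant1979, Lemma 3.1] -/
def ent0 (φ : CNF ν) (r s : ℕ) : ℤ :=
  if r = s + 1 then 1 else if s < r then 0
  else if r < 7 * (s / 7) then 0
  else locZ (φ.getD (s / 7) []) (r - 7 * (s / 7)) (s + 1 - 7 * (s / 7))

/-- The integer column `dpos o` of the original block with `Y_{var o} := 1`: the subdiagonal `1`,
the substituted variable `1`, and the constant `p` of the literal above it. [cite: Valiant1979, Lemma 3.1] -/
def colR (φ : CNF ν) (r o : ℕ) : ℤ :=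
  if r = dpos o + 1 then 1 else if r = dpos o then 1
  else if r + 1 = dpos o then (match lit? φ o with | some l => litPZ l | none => 0) else 0

variable [DecidableEq ν]

/-- **Valiant's integer matrix of a 3-CNF in closed form** (Valiant 1979, Lemma 3.1, with the
BCS junction blocks and `ε = 1`): on `I3 n₀ W`; see the module docstring. The formula enters only
through clause/literal lookups, polarities, `dpos`, and the variable-equality predicates
`isFirst3`/`isLast3`/`isNext3`/`var? _ = var? _`. [cite: Valiant1979, Lemma 3.1] -/
def M3 (φ : CNF ν) (n₀ W : ℕ) : Matrix (I3 n₀ W) (I3 n₀ W) ℤ := fun x y =>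
  match x, y with
  | Sum.inl r, Sum.inl s => ent0 φ r.val s.val
  | Sum.inl r, Sum.inr (Sum.inl (o, Sum.inr p)) => if p = 3 then colR φ r.val o.val else 0
  | Sum.inl _, Sum.inr (Sum.inl (_, Sum.inl _)) => 0
  | Sum.inl _, Sum.inr (Sum.inr _) => 0
  | Sum.inr (Sum.inl (o, Sum.inl p)), Sum.inr (Sum.inl (o', Sum.inl p')) =>
      if o = o' then valiantV p p'
      else if p = 0 ∧ p' = 3 ∧ isNext3 φ o.val o'.val then 1 else 0
  | Sum.inr (Sum.inl (o, Sum.inl p)), Sum.inr (Sum.inr o') =>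
      if p = 0 ∧ isLast3 φ W o.val ∧ isFirst3 φ o'.val ∧ var? φ o'.val = var? φ o.val then 1 else 0
  | Sum.inr (Sum.inl (o, Sum.inl p)), Sum.inr (Sum.inl (o', Sum.inr p')) =>
      if o = o' ∧ p = 3 ∧ p' = 0 then 1 else 0
  | Sum.inr (Sum.inl (_, Sum.inl _)), Sum.inl _ => 0
  | Sum.inr (Sum.inl (o, Sum.inr p)), Sum.inr (Sum.inl (o', Sum.inr p')) =>
      if o = o' then valiantV p p' else 0
  | Sum.inr (Sum.inl (o, Sum.inr p)), Sum.inl s => if p = 0 ∧ s.val = dpos o.val then 1 else 0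
  | Sum.inr (Sum.inl (o, Sum.inr p)), Sum.inr (Sum.inl (o', Sum.inl p')) =>
      if o = o' ∧ p = 3 ∧ p' = 0 then 1 else 0
  | Sum.inr (Sum.inl (_, Sum.inr _)), Sum.inr (Sum.inr _) => 0
  | Sum.inr (Sum.inr o), Sum.inr (Sum.inr o') => if o = o' then 1 else 0
  | Sum.inr (Sum.inr o), Sum.inr (Sum.inl (o', Sum.inl p')) =>
      if isFirst3 φ o.val ∧ o' = o ∧ p' = 3 then 1 else 0
  | Sum.inr (Sum.inr _), Sum.inr (Sum.inl (_, Sum.inr _)) => 0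
  | Sum.inr (Sum.inr _), Sum.inl _ => 0

end M3Def

/-! ### `M3` is the all-at-once matrix of `cnfMatrix`, plus isolated unit loops -/

section Compare

/-- Reading an entry over `ℤ ∪ ∅` as an integer. [folklore] -/
def toZ : ℤ ⊕ Empty → ℤ := Sum.elim id Empty.elim

/-- `toZ` of a constant. [folklore] -/
@[simp] theorem toZ_inl (c : ℤ) : toZ (Sum.inl c) = c := rfl

variable (φ : CNF (Fin t))

/-- The 3-CNF matrix over `ℤ`, with no `X`-variables. [cite: Valiant1979, Lemma 3.1] -/
abbrev A3 : Matrix (Fin (cnfDim φ)) (Fin (cnfDim φ)) (ℤ ⊕ (Empty ⊕ Fin t)) := cnfMatrix φ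

/-- `litS` over `ℤ` is `litSZ`. [folklore] -/
theorem litS_eq (l : Literal (Fin t)) : litS (k := ℤ) l = litSZ l := rfl
/-- `litP` over `ℤ` is `litPZ`. [folklore] -/
theorem litP_eq (l : Literal (Fin t)) : litP (k := ℤ) l = litPZ l := rfl

/-- The original block with `Y := 0` is `ent0`, locally. [cite: Valiant1979, Lemma 3.1] -/
theorem toZ_bse_locW (ls : List (Literal (Fin t))) (a b : ℕ) :
    toZ (boolSubstEntry (fun _ : Fin t => false) (locW (k := ℤ) (σ := Empty) ls a b)) = locZ ls a b := by
  unfold locW locZ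
  by_cases hb : b = 7
  · rw [if_pos hb, if_pos hb]; rfl
  rw [if_neg hb, if_neg hb]
  cases ls[(b - 1) / 2]? with
  | none => rfl
  | some l =>
    dsimp only
    split_ifs <;> rfl

/-- The original block with `Y := 0` is `ent0`. [cite: Valiant1979, Lemma 3.1] -/
theorem toZ_bse_ent3 (r s : ℕ) :
    toZ (boolSubstEntry (fun _ : Fin t => false) (ent3 (k := ℤ) (σ := Empty) φ r s)) = ent0 φ r s := by
  unfold ent3 ent0
  split_ifs <;> first | rfl | exact toZ_bse_locW _ _ _

/-- The column of an occurrence with its variable set to `1` is `colR`. [cite: Valiant1979, Lemma 3.1] -/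
theorem toZ_bse_col (hw : CNF.IsWidthEq 3 φ) (o : Fin (3 * φ.length)) (r : ℕ) :
    toZ (boolSubstEntry (fun j : Fin t => decide (j = (lit3 φ hw o).1))
      (ent3 (k := ℤ) (σ := Empty) φ r (dpos o.val))) = colR φ r o.val := by
  have ho := o.isLt
  have hj : o.val / 3 < φ.length := by omega
  have hq : dpos o.val / 7 = o.val / 3 := by unfold dpos; omega
  have hi : o.val % 3 < (φ[o.val / 3]).length := by
    rw [hw _ (List.getElem_mem _)]; exact Nat.mod_lt _ (by norm_num)
  unfold ent3 colR
  by_cases h1 : r = dpos o.val + 1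
  · rw [if_pos h1, if_pos h1]; rfl
  rw [if_neg h1, if_neg h1]
  by_cases h2 : dpos o.val < r
  · rw [if_pos h2, if_neg (by omega), if_neg (by omega)]; rfl
  rw [if_neg h2, hq]
  by_cases h3 : r < 7 * (o.val / 3)
  · rw [if_pos h3, if_neg (by unfold dpos at h2 ⊢; omega), if_neg (by unfold dpos at h2 ⊢; omega)]; rfl
  rw [if_neg h3, List.getD_eq_getElem _ _ hj]
  unfold locW
  have hb : dpos o.val + 1 - 7 * (o.val / 3) = 2 * (o.val % 3) + 2 := by unfold dpos; omega
  have hidx : (2 * (o.val % 3) + 2 - 1) / 2 = o.val % 3 := by omega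
  rw [hb, if_neg (by omega), hidx, List.getElem?_eq_getElem hi, lit?_eq φ hw o]
  dsimp only
  rw [if_neg (by omega)]
  by_cases h5 : r - 7 * (o.val / 3) = 2 * (o.val % 3) ∧ 2 * (o.val % 3) + 2 = 2 * (o.val % 3) + 2
  · rw [if_pos h5, if_neg (by unfold dpos; omega), if_pos (by unfold dpos; omega)]; rfl
  rw [if_neg h5]
  by_cases h6 : r - 7 * (o.val / 3) = 2 * (o.val % 3) + 1 ∧ 2 * (o.val % 3) + 2 = 2 * (o.val % 3) + 2
  · rw [if_pos h6, if_pos (by unfold dpos; omega)]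
    simp [boolSubstEntry, lit3]
  · rw [if_neg h6, if_neg (by unfold dpos at h2 ⊢; omega), if_neg (by unfold dpos at h2 ⊢; omega)]; rfl

variable (hw : CNF.IsWidthEq 3 φ)

/-- The inert control slots: occurrences that are not the first of their variable. [cite: Valiant1979, Lemma 3.1] -/
abbrev Inert : Type := {o : Fin (3 * φ.length) // ¬ isFirst3 φ o.val}

/-- Decidable equality of the extended index type, pre-assembled (the synthesised term exceeds the
default instance size bound). [folklore] -/
instance instDecidableEqExt : DecidableEq (AIdx (A3 φ) ⊕ Inert φ) := instDecidableEqSum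

/-- The all-at-once matrix of the 3-CNF matrix read over `ℤ`, extended by isolated unit loops on
the inert control slots. [cite: Valiant1979, Lemma 3.1] -/
def Mext : Matrix (AIdx (A3 φ) ⊕ Inert φ) (AIdx (A3 φ) ⊕ Inert φ) ℤ :=
  Matrix.fromBlocks ((allAtOnce (A3 φ)).map toZ) 0 0 1

/-- The re-indexing of the comparison: `I3 (cnfDim φ) (3m) → AIdx (A3 φ) ⊕ Inert φ`. [cite: Valiant1979, Lemma 3.1] -/
def Θ : I3 (cnfDim φ) (3 * φ.length) → AIdx (A3 φ) ⊕ Inert φ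
  | Sum.inl r => Sum.inl (ao _ r)
  | Sum.inr (Sum.inl (o, Sum.inl p)) => Sum.inl (aL _ (occOf (k := ℤ) (σ := Empty) φ hw o) p)
  | Sum.inr (Sum.inl (o, Sum.inr p)) => Sum.inl (aR _ (occOf (k := ℤ) (σ := Empty) φ hw o) p)
  | Sum.inr (Sum.inr o) =>
      if h : isFirst3 φ o.val then Sum.inl (ac _ (lit3 φ hw o).1) else Sum.inr ⟨o, h⟩

/-- Two first occurrences of the same variable coincide. [folklore] -/
theorem eq_of_isFirst3 {o o' : Fin (3 * φ.length)} (h : isFirst3 φ o.val) (h' : isFirst3 φ o'.val)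
    (hv : (lit3 φ hw o).1 = (lit3 φ hw o').1) : o = o' := by
  rcases lt_trichotomy o o' with hlt | heq | hgt
  · exact absurd ((var?_eq_var?_iff φ hw o o').2 hv) (h' o.val hlt)
  · exact heq
  · exact absurd ((var?_eq_var?_iff φ hw o' o).2 hv.symm) (h o'.val hgt)

/-- **Entries agree** through `Θ`. [cite: Valiant1979, Lemma 3.1] -/
theorem Mext_Θ (x y : I3 (cnfDim φ) (3 * φ.length)) :
    Mext φ (Θ φ hw x) (Θ φ hw y) = M3 φ (cnfDim φ) (3 * φ.length) x y := by
  rcases x with r | ⟨o, p | p⟩ | o <;> rcases y with s | ⟨o', p' | p'⟩ | o'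
  -- row: original
  · simp only [Θ, Mext, Matrix.fromBlocks_apply₁₁, Matrix.map_apply, allAtOnce_o_o, M3,
      cnfMatrix_eq_ent3 φ hw, toZ_bse_ent3]
  · simp only [Θ, Mext, Matrix.fromBlocks_apply₁₁, Matrix.map_apply, allAtOnce_o_L, M3, toZ_inl]
  · simp only [Θ, Mext, Matrix.fromBlocks_apply₁₁, Matrix.map_apply, allAtOnce_o_R, M3, occOf_var]
    split_ifs with hp
    · show toZ (boolSubstEntry _ (cnfMatrix φ r (dposFin φ hw o'))) = _
      rw [cnfMatrix_eq_ent3 φ hw]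
      exact toZ_bse_col φ hw o' r.val
    · rfl
  · by_cases h' : isFirst3 φ o'.val
    · simp only [Θ, h', dif_pos, Mext, Matrix.fromBlocks_apply₁₁, Matrix.map_apply, allAtOnce_o_c, M3, toZ_inl]
    · simp only [Θ, h', dif_neg, not_false_eq_true, Mext, Matrix.fromBlocks_apply₁₂, M3, Matrix.zero_apply]
  -- row: `L_{o,p}`
  · simp only [Θ, Mext, Matrix.fromBlocks_apply₁₁, Matrix.map_apply, allAtOnce_L_o, M3, toZ_inl]
  · simp only [Θ, Mext, Matrix.fromBlocks_apply₁₁, Matrix.map_apply, allAtOnce_L_L, M3,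
      occOf_eq_iff, isNext_occOf_iff]
    split_ifs <;> rfl
  · simp only [Θ, Mext, Matrix.fromBlocks_apply₁₁, Matrix.map_apply, allAtOnce_L_R, M3, occOf_eq_iff]
    split_ifs <;> rfl
  · by_cases h' : isFirst3 φ o'.val
    · simp only [Θ, h', dif_pos, Mext, Matrix.fromBlocks_apply₁₁, Matrix.map_apply, allAtOnce_L_c, M3,
        isLast_occOf_iff, occOf_var, ← var?_eq_var?_iff φ hw, true_and]
      by_cases hc : p = 0 ∧ isLast3 φ (3 * φ.length) o.val ∧ var? φ o.val = var? φ o'.val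
      · rw [if_pos hc, if_pos ⟨hc.1, hc.2.1, hc.2.2.symm⟩]; rfl
      · rw [if_neg hc, if_neg (fun h => hc ⟨h.1, h.2.1, h.2.2.symm⟩)]; rfl
    · simp only [Θ, h', dif_neg, not_false_eq_true, Mext, Matrix.fromBlocks_apply₁₂, M3, Matrix.zero_apply,
        false_and, and_false, if_false]
  -- row: `R_{o,p}`
  · simp only [Θ, Mext, Matrix.fromBlocks_apply₁₁, Matrix.map_apply, allAtOnce_R_o, M3, Fin.ext_iff,
      occOf_snd_val]
    split_ifs <;> rfl
  · simp only [Θ, Mext, Matrix.fromBlocks_apply₁₁, Matrix.map_apply, allAtOnce_R_L, M3, occOf_eq_iff]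
    split_ifs <;> rfl
  · simp only [Θ, Mext, Matrix.fromBlocks_apply₁₁, Matrix.map_apply, allAtOnce_R_R, M3, occOf_eq_iff]
    split_ifs <;> rfl
  · by_cases h' : isFirst3 φ o'.val
    · simp only [Θ, h', dif_pos, Mext, Matrix.fromBlocks_apply₁₁, Matrix.map_apply, allAtOnce_R_c, M3, toZ_inl]
    · simp only [Θ, h', dif_neg, not_false_eq_true, Mext, Matrix.fromBlocks_apply₁₂, M3, Matrix.zero_apply]
  -- row: control
  · by_cases h : isFirst3 φ o.val
    · simp only [Θ, h, dif_pos, Mext, Matrix.fromBlocks_apply₁₁, Matrix.map_apply, allAtOnce_c_o, M3, toZ_inl]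
    · simp only [Θ, h, dif_neg, not_false_eq_true, Mext, Matrix.fromBlocks_apply₂₁, M3, Matrix.zero_apply]
  · by_cases h : isFirst3 φ o.val
    · simp only [Θ, h, dif_pos, Mext, Matrix.fromBlocks_apply₁₁, Matrix.map_apply, allAtOnce_c_L, M3,
        isFirst_occOf_iff, occOf_var, true_and]
      by_cases hc : o' = o ∧ p' = 3
      · obtain ⟨rfl, hp⟩ := hc
        rw [if_pos ⟨h, rfl, hp⟩, if_pos ⟨rfl, hp⟩]; rfl
      · rw [if_neg hc, if_neg]
        · rfl
        · rintro ⟨h1, h2, h3⟩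
          exact hc ⟨eq_of_isFirst3 φ hw h1 h h2, h3⟩
    · simp only [Θ, h, dif_neg, not_false_eq_true, Mext, Matrix.fromBlocks_apply₂₁, M3, Matrix.zero_apply,
        false_and, if_false]
  · by_cases h : isFirst3 φ o.val
    · simp only [Θ, h, dif_pos, Mext, Matrix.fromBlocks_apply₁₁, Matrix.map_apply, allAtOnce_c_R, M3, toZ_inl]
    · simp only [Θ, h, dif_neg, not_false_eq_true, Mext, Matrix.fromBlocks_apply₂₁, M3, Matrix.zero_apply]
  · by_cases h : isFirst3 φ o.val <;> by_cases h' : isFirst3 φ o'.val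
    · simp only [Θ, h, h', dif_pos, Mext, Matrix.fromBlocks_apply₁₁, Matrix.map_apply, allAtOnce_c_c, M3]
      by_cases hoo : o = o'
      · subst hoo; rw [if_pos rfl, if_pos rfl]; rfl
      · rw [if_neg (fun hv => hoo (eq_of_isFirst3 φ hw h h' hv)), if_neg hoo]; rfl
    · have hoo : o ≠ o' := fun heq => h' (heq ▸ h)
      simp only [Θ, h, h', dif_pos, dif_neg, not_false_eq_true, Mext, Matrix.fromBlocks_apply₁₂, M3,
        Matrix.zero_apply, hoo, if_false]
    · have hoo : o ≠ o' := fun heq => h (heq ▸ h')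
      simp only [Θ, h, h', dif_pos, dif_neg, not_false_eq_true, Mext, Matrix.fromBlocks_apply₂₁, M3,
        Matrix.zero_apply, hoo, if_false]
    · simp only [Θ, h, h', dif_neg, not_false_eq_true, Mext, Matrix.fromBlocks_apply₂₂, M3, Matrix.one_apply,
        Subtype.mk.injEq]

/-- `Θ` is injective. [cite: Valiant1979, Lemma 3.1] -/
theorem Θ_injective : Function.Injective (Θ φ hw) := by
  intro x y hxy
  rcases x with r | ⟨o, p | p⟩ | o <;> rcases y with s | ⟨o', p' | p'⟩ | o'
  · simpa [Θ] using hxy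
  · simp [Θ] at hxy
  · simp [Θ] at hxy
  · by_cases h' : isFirst3 φ o'.val <;> simp [Θ, h'] at hxy
  · simp [Θ] at hxy
  · simp only [Θ, Sum.inl.injEq, Sum.inr.injEq, Prod.mk.injEq, occOf_eq_iff] at hxy
    rw [hxy.1, hxy.2]
  · simp [Θ] at hxy
  · by_cases h' : isFirst3 φ o'.val <;> simp [Θ, h'] at hxy
  · simp [Θ] at hxy
  · simp [Θ] at hxy
  · simp only [Θ, Sum.inl.injEq, Sum.inr.injEq, Prod.mk.injEq, occOf_eq_iff] at hxy
    rw [hxy.1, hxy.2]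
  · by_cases h' : isFirst3 φ o'.val <;> simp [Θ, h'] at hxy
  · by_cases h : isFirst3 φ o.val <;> simp [Θ, h] at hxy
  · by_cases h : isFirst3 φ o.val <;> simp [Θ, h] at hxy
  · by_cases h : isFirst3 φ o.val <;> simp [Θ, h] at hxy
  · by_cases h : isFirst3 φ o.val <;> by_cases h' : isFirst3 φ o'.val
    · simp only [Θ, h, h', dif_pos, Sum.inl.injEq, Sum.inr.injEq] at hxy
      rw [eq_of_isFirst3 φ hw h h' hxy]
    · simp [Θ, h, h'] at hxy
    · simp [Θ, h, h'] at hxy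
    · simp only [Θ, h, h', dif_neg, not_false_eq_true, Sum.inr.injEq, Subtype.mk.injEq] at hxy
      rw [hxy]

/-- `Θ` is surjective when every variable occurs. [cite: Valiant1979, Lemma 3.1] -/
theorem Θ_surjective (hocc : ∀ v : Fin t, ∃ o : Fin (3 * φ.length), (lit3 φ hw o).1 = v) :
    Function.Surjective (Θ φ hw) := by
  intro z
  rcases z with (r | ⟨õ, p | p⟩ | v) | ⟨o, h⟩
  · exact ⟨Sum.inl r, rfl⟩
  · obtain ⟨o, rfl⟩ := exists_occOf (k := ℤ) (σ := Empty) φ hw õ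
    exact ⟨Sum.inr (Sum.inl (o, Sum.inl p)), rfl⟩
  · obtain ⟨o, rfl⟩ := exists_occOf (k := ℤ) (σ := Empty) φ hw õ
    exact ⟨Sum.inr (Sum.inl (o, Sum.inr p)), rfl⟩
  · -- the first occurrence of `v`
    classical
    have hex : ∃ n, ∃ hn : n < 3 * φ.length, (lit3 φ hw ⟨n, hn⟩).1 = v := by
      obtain ⟨o, ho⟩ := hocc v; exact ⟨o.val, o.isLt, ho⟩
    obtain ⟨hn₀, hv⟩ := Nat.find_spec hex
    have hfirst : isFirst3 φ (Nat.find hex) := by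
      intro o' ho' hvar
      have ho'3 : o' < 3 * φ.length := lt_trans ho' hn₀
      have := Nat.find_min hex ho'
      exact this ⟨ho'3, ((var?_eq_var?_iff φ hw ⟨o', ho'3⟩ ⟨Nat.find hex, hn₀⟩).1 hvar).trans hv⟩
    refine ⟨Sum.inr (Sum.inr ⟨Nat.find hex, hn₀⟩), ?_⟩
    simp only [Θ, hfirst, dif_pos]
    rw [hv]
  · exact ⟨Sum.inr (Sum.inr o), by simp [Θ, h]⟩

/-- `Θ` as an equivalence. [cite: Valiant1979, Lemma 3.1] -/
def ΘEquiv (hocc : ∀ v : Fin t, ∃ o : Fin (3 * φ.length), (lit3 φ hw o).1 = v) :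
    I3 (cnfDim φ) (3 * φ.length) ≃ AIdx (A3 φ) ⊕ Inert φ :=
  Equiv.ofBijective (Θ φ hw) ⟨Θ_injective φ hw, Θ_surjective φ hw hocc⟩

/-- **`M3` is a re-indexing of the extended all-at-once matrix.** [cite: Valiant1979, Lemma 3.1] -/
theorem M3_eq_submatrix (hocc : ∀ v : Fin t, ∃ o : Fin (3 * φ.length), (lit3 φ hw o).1 = v) :
    M3 φ (cnfDim φ) (3 * φ.length) = (Mext φ).submatrix (ΘEquiv φ hw hocc) (ΘEquiv φ hw hocc) := by
  ext x y
  exact (Mext_Θ φ hw x y).symm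

end Compare

/-! ### The permanent of `M3` -/

section Permanent

variable (φ : CNF (Fin t)) (hw : CNF.IsWidthEq 3 φ)

/-- Evaluation of `ℤ[∅]` in `ℤ`. [folklore] -/
def evZ : MvPolynomial Empty ℤ →+* ℤ := MvPolynomial.eval fun e => e.elim

/-- `evZ` of a constant. [folklore] -/
@[simp] theorem evZ_C (c : ℤ) : evZ (C c) = c := by simp [evZ]

/-- Reading a matrix over `ℤ ∪ ∅` as integers is evaluating its polynomial entries. [folklore] -/
theorem map_toZ_eq {ι : Type*} (M : Matrix ι ι (ℤ ⊕ Empty)) : M.map toZ = (M.map entryVal).map evZ := by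
  ext i j
  rcases hM : M i j with c | e
  · simp [Matrix.map_apply, hM, toZ, evZ]
  · exact e.elim

/-- **The permanent of `M3` for a 3-CNF over `Fin t` in which every variable occurs**:
`per M3 = 16^{3m} · #{e | e ⊨ φ}`. [cite: Valiant1979, Lemma 3.1] -/
theorem permanent_M3_fin (hocc : ∀ v : Fin t, ∃ o : Fin (3 * φ.length), (lit3 φ hw o).1 = v) :
    (M3 φ (cnfDim φ) (3 * φ.length)).permanent =
      16 ^ (3 * φ.length) * ((univ.filter fun e : Fin t → Bool => φ.eval e = true).card : ℤ) := by
  have hoccA : ∀ j : Fin t, ∃ õ : Occ (A3 φ), õ.var = j := fun j => by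
    obtain ⟨o, ho⟩ := hocc j
    exact ⟨occOf φ hw o, by rw [occOf_var, ho]⟩
  have key := perY_allAtOnce (k := ℤ) (σ := Empty) t (A3 φ) (hasColumnProperty_cnfMatrix φ) hoccA
  unfold perY at key
  have h1 : (Mext φ).permanent = ((allAtOnce (A3 φ)).map toZ).permanent := by
    unfold Mext
    refine (Matrix.permanent_fromBlocks_zero₂₁ _ _ _).trans ?_
    simp only [Matrix.permanent_one, mul_one]
  have h2 : ((allAtOnce (A3 φ)).map toZ).permanent = evZ (((allAtOnce (A3 φ)).map entryVal).permanent) := by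
    rw [map_toZ_eq, Matrix.permanent_map_ringHom]
  rw [M3_eq_submatrix φ hw hocc, Matrix.permanent_submatrix_equiv, h1, h2, key, map_mul, evZ_C,
    card_occ_cnfMatrix (k := ℤ) (σ := Empty) φ hw, map_sum]
  congr 1
  simp_rw [entryPer_boolSubst_cnfMatrix, apply_ite evZ, map_one, map_zero]
  rw [Finset.sum_ite, Finset.sum_const_zero, add_zero, Finset.sum_const, nsmul_eq_mul, mul_one]

end Permanent

/-! ### Invariance under renaming of the variables -/

section Rename

variable {ν ν' : Type*}

/-- Renaming the variables of a CNF. [folklore] -/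
def renameCNF (f : ν → ν') (φ : CNF ν) : CNF ν' := φ.map fun c => c.map fun l => (f l.1, l.2)

/-- Renaming keeps the number of clauses. [folklore] -/
@[simp] theorem length_renameCNF (f : ν → ν') (φ : CNF ν) : (renameCNF f φ).length = φ.length := by
  simp [renameCNF]

/-- Renaming keeps the widths. [folklore] -/
theorem isWidthEq_renameCNF (f : ν → ν') {φ : CNF ν} {w : ℕ} (hw : CNF.IsWidthEq w φ) :
    CNF.IsWidthEq w (renameCNF f φ) := by
  intro c hc
  simp only [renameCNF, List.mem_map] at hc
  obtain ⟨c', hc', rfl⟩ := hc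
  rw [List.length_map, hw c' hc']

/-- Renaming keeps `cnfDim`. [folklore] -/
theorem cnfDim_renameCNF (f : ν → ν') : ∀ φ : CNF ν, cnfDim (renameCNF f φ) = cnfDim φ
  | [] => rfl
  | c :: cs => by
    simp only [renameCNF, List.map_cons, cnfDim_cons, List.length_map]
    rw [← cnfDim_renameCNF f cs]; rfl

/-- Literal lookup commutes with renaming. [folklore] -/
theorem lit?_renameCNF (f : ν → ν') (φ : CNF ν) (o : ℕ) :
    lit? (renameCNF f φ) o = (lit? φ o).map fun l => (f l.1, l.2) := by
  simp only [lit?, renameCNF, List.getElem?_map]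
  cases φ[o / 3]? with
  | none => rfl
  | some c => simp [List.getElem?_map]

/-- Variable lookup commutes with renaming. [folklore] -/
theorem var?_renameCNF (f : ν → ν') (φ : CNF ν) (o : ℕ) :
    var? (renameCNF f φ) o = (var? φ o).map f := by
  rw [var?, var?, lit?_renameCNF, Option.map_map, Option.map_map]; rfl

/-- Evaluation of a renamed CNF is evaluation at the composed assignment. [folklore] -/
theorem eval_renameCNF (f : ν → ν') (φ : CNF ν) (e : ν' → Bool) :
    (renameCNF f φ).eval e = φ.eval (e ∘ f) := by
  unfold CNF.eval renameCNF
  rw [List.all_map]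
  congr 1
  funext c
  simp only [Function.comp_apply, List.any_map]
  congr 1

/-- The integer local table depends on the clause only through the polarities. [folklore] -/
theorem locZ_map (f : ν → ν') (ls : List (Literal ν)) (a b : ℕ) :
    locZ (ls.map fun l => (f l.1, l.2)) a b = locZ ls a b := by
  unfold locZ
  rw [List.getElem?_map]
  cases ls[(b - 1) / 2]? <;> rfl

/-- `ent0` is invariant under renaming. [folklore] -/
theorem ent0_renameCNF (f : ν → ν') (φ : CNF ν) (r s : ℕ) : ent0 (renameCNF f φ) r s = ent0 φ r s := by
  unfold ent0
  have : (renameCNF f φ).getD (s / 7) [] = (φ.getD (s / 7) []).map fun l => (f l.1, l.2) := by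
    simp only [renameCNF, List.getD_eq_getElem?_getD, List.getElem?_map]
    cases φ[s / 7]? <;> rfl
  rw [this, locZ_map]

/-- `colR` is invariant under renaming. [folklore] -/
theorem colR_renameCNF (f : ν → ν') (φ : CNF ν) (r o : ℕ) : colR (renameCNF f φ) r o = colR φ r o := by
  unfold colR
  rw [lit?_renameCNF]
  cases lit? φ o <;> rfl

variable [DecidableEq ν] [DecidableEq ν']

/-- **`M3` is invariant under a renaming that is injective on the occurring variables.** [cite: Valiant1979, Lemma 3.1] -/
theorem M3_renameCNF (f : ν → ν') (φ : CNF ν)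
    (hf : ∀ o o', (var? φ o).map f = (var? φ o').map f → var? φ o = var? φ o') (n₀ W : ℕ) :
    M3 (renameCNF f φ) n₀ W = M3 φ n₀ W := by
  have hv : ∀ o o', var? (renameCNF f φ) o = var? (renameCNF f φ) o' ↔ var? φ o = var? φ o' := by
    intro o o'
    rw [var?_renameCNF, var?_renameCNF]
    exact ⟨hf o o', fun h => by rw [h]⟩
  have hF : ∀ o, isFirst3 (renameCNF f φ) o ↔ isFirst3 φ o := fun o => by
    unfold isFirst3; simp only [ne_eq, hv]
  have hL : ∀ o, isLast3 (renameCNF f φ) W o ↔ isLast3 φ W o := fun o => by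
    unfold isLast3; simp only [ne_eq, hv]
  have hN : ∀ o o', isNext3 (renameCNF f φ) o o' ↔ isNext3 φ o o' := fun o o' => by
    unfold isNext3; simp only [ne_eq, hv]
  ext x y
  rcases x with r | ⟨o, p | p⟩ | o <;> rcases y with s' | ⟨o', p' | p'⟩ | o' <;>
    simp only [M3, ent0_renameCNF, colR_renameCNF, hF, hL, hN, hv]

end Rename

/-! ### 3-CNFs over `ℕ`: `per M3 = 16^{3m} · numSat` -/

section Nat

variable (ψ : CNF ℕ)

/-- Membership in `vars`, unfolded. [folklore] -/
theorem mem_vars_iff (x : ℕ) : x ∈ ψ.vars ↔ ∃ c ∈ ψ, ∃ l ∈ c, l.1 = x := by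
  simp only [CNF.vars, List.mem_toFinset, List.mem_map, List.mem_flatten]
  constructor
  · rintro ⟨l, ⟨c, hc, hl⟩, rfl⟩; exact ⟨c, hc, l, hl, rfl⟩
  · rintro ⟨c, hc, l, hl, rfl⟩; exact ⟨l, ⟨c, hc, hl⟩, rfl⟩

/-- The variable of an occurrence is an occurring variable. [folklore] -/
theorem mem_vars_of_var? {o : ℕ} {x : ℕ} (h : var? ψ o = some x) : x ∈ ψ.vars := by
  rw [mem_vars_iff]
  unfold var? lit? at h
  cases hc : ψ[o / 3]? with
  | none => rw [hc] at h; simp at h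
  | some c =>
    rw [hc, Option.bind_some] at h
    cases hl : c[o % 3]? with
    | none => rw [hl] at h; simp at h
    | some l =>
      rw [hl] at h
      simp only [Option.map_some, Option.some.injEq] at h
      exact ⟨c, List.mem_of_getElem? hc, l, List.mem_of_getElem? hl, h⟩

/-- The total renaming of `ℕ` onto `Fin |vars|` (the enumeration `ψ.vars.equivFin` on the occurring
variables, junk `0` elsewhere; needs a variable to occur). [folklore] -/
def rk (hne : ψ.vars.Nonempty) (x : ℕ) : Fin ψ.vars.card :=
  if h : x ∈ ψ.vars then ψ.vars.equivFin ⟨x, h⟩ else ⟨0, Finset.card_pos.2 hne⟩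

/-- The CNF over `Fin |vars|`. [folklore] -/
def finCNF (hne : ψ.vars.Nonempty) : CNF (Fin ψ.vars.card) := renameCNF (rk ψ hne) ψ

/-- `rk` is injective on the occurring variables, in the form `M3_renameCNF` consumes. [folklore] -/
theorem rk_hf (hne : ψ.vars.Nonempty) (o o' : ℕ)
    (h : (var? ψ o).map (rk ψ hne) = (var? ψ o').map (rk ψ hne)) : var? ψ o = var? ψ o' := by
  cases ho : var? ψ o with
  | none =>
    cases ho' : var? ψ o' with
    | none => rfl
    | some x' => rw [ho, ho'] at h; simp at h
  | some x =>
    cases ho' : var? ψ o' with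
    | none => rw [ho, ho'] at h; simp at h
    | some x' =>
      rw [ho, ho'] at h
      simp only [Option.map_some, Option.some.injEq] at h
      have hx := mem_vars_of_var? ψ ho
      have hx' := mem_vars_of_var? ψ ho'
      simp only [rk, hx, hx', dif_pos, Equiv.apply_eq_iff_eq, Subtype.mk.injEq] at h
      rw [h]

/-- **Every variable of `finCNF ψ` occurs** (as a literal of some occurrence `o < 3m`). [folklore] -/
theorem finCNF_occ (hw : CNF.IsWidthEq 3 ψ) (hne : ψ.vars.Nonempty) (v : Fin ψ.vars.card) :
    ∃ o : Fin (3 * (finCNF ψ hne).length),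
      (lit3 (finCNF ψ hne) (isWidthEq_renameCNF _ hw) o).1 = v := by
  obtain ⟨⟨x, hx⟩, hxv⟩ := ψ.vars.equivFin.surjective v
  obtain ⟨c, hc, l, hl, rfl⟩ := (mem_vars_iff ψ x).1 hx
  obtain ⟨j, hj, rfl⟩ := List.mem_iff_getElem.1 hc
  obtain ⟨i, hi, rfl⟩ := List.mem_iff_getElem.1 hl
  have hi3 : i < 3 := by rw [hw _ (List.getElem_mem hj)] at hi; exact hi
  have ho : 3 * j + i < 3 * (finCNF ψ hne).length := by rw [finCNF, length_renameCNF]; omega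
  refine ⟨⟨3 * j + i, ho⟩, ?_⟩
  have key1 := lit?_eq (finCNF ψ hne) (isWidthEq_renameCNF _ hw) ⟨3 * j + i, ho⟩
  have key2 : lit? (finCNF ψ hne) (3 * j + i) = some (rk ψ hne (ψ[j][i]).1, (ψ[j][i]).2) := by
    unfold finCNF
    rw [lit?_renameCNF]
    have h1 : (3 * j + i) / 3 = j := by omega
    have h2 : (3 * j + i) % 3 = i := by omega
    simp [lit?, h1, h2, List.getElem?_eq_getElem hj, List.getElem?_eq_getElem hi]
  rw [Option.some_inj.1 (key1.symm.trans key2)]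
  show rk ψ hne (ψ[j][i]).1 = v
  simp only [rk, hx, dif_pos]
  exact hxv

/-- **`#{e | e ⊨ finCNF ψ} = numSat ψ`.** [folklore] -/
theorem card_sat_finCNF (hne : ψ.vars.Nonempty) :
    (univ.filter fun e : Fin ψ.vars.card → Bool => (finCNF ψ hne).eval e = true).card = ψ.numSat := by
  unfold CNF.numSat
  symm
  refine Finset.card_bij (fun σ _ => σ ∘ ψ.vars.equivFin.symm) (fun σ hσ => ?_) (fun σ _ σ' _ h => ?_)
    (fun e he => ?_)
  · simp only [Finset.mem_filter, Finset.mem_univ, true_and] at hσ ⊢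
    unfold finCNF
    rw [eval_renameCNF]
    have hres := CNF.eval_extendAssignment_restrict ψ ((σ ∘ ψ.vars.equivFin.symm) ∘ rk ψ hne)
    have hfun : (fun x : ψ.vars => ((σ ∘ ψ.vars.equivFin.symm) ∘ rk ψ hne) x) = σ := by
      funext x
      have hx : (x : ℕ) ∈ ψ.vars := x.2
      simp [rk, hx]
    rw [hfun] at hres
    rw [← hres]
    exact hσ
  · funext x
    have := congrFun h (ψ.vars.equivFin x)
    simpa using this
  · refine ⟨e ∘ ψ.vars.equivFin, ?_, by funext v; simp⟩
    simp only [Finset.mem_filter, Finset.mem_univ, true_and] at he ⊢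
    unfold finCNF at he
    rw [eval_renameCNF] at he
    have hres := CNF.eval_extendAssignment_restrict ψ (e ∘ rk ψ hne)
    have hfun : (fun x : ψ.vars => (e ∘ rk ψ hne) x) = e ∘ ψ.vars.equivFin := by
      funext x
      have hx : (x : ℕ) ∈ ψ.vars := x.2
      simp [rk, hx]
    rw [hfun] at hres
    rw [hres]
    exact he

/-- A 3-CNF without clauses. [folklore] -/
theorem eq_nil_of_vars_empty (hw : CNF.IsWidthEq 3 ψ) (h : ¬ ψ.vars.Nonempty) : ψ = [] := by
  rcases ψ with _ | ⟨c, cs⟩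
  · rfl
  · exfalso
    apply h
    have hc : c.length = 3 := hw c (by simp)
    obtain ⟨l₀, l₁, l₂, rfl⟩ := List.length_eq_three.1 hc
    exact ⟨l₀.1, (mem_vars_iff _ _).2 ⟨[l₀, l₁, l₂], by simp, l₀, by simp, rfl⟩⟩

/-- **The permanent of Valiant's matrix of a 3-CNF** (Valiant 1979, Lemma 3.1 in the form proved
here): for a 3-CNF `ψ` over `ℕ` with `m` clauses, `per (M3 ψ (7m) (3m)) = 16^{3m} · numSat ψ`. [cite: Valiant1979, Lemma 3.1] -/
theorem permanent_M3 (hw : CNF.IsWidthEq 3 ψ) :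
    (M3 ψ (7 * ψ.length) (3 * ψ.length)).permanent = 16 ^ (3 * ψ.length) * (ψ.numSat : ℤ) := by
  by_cases hne : ψ.vars.Nonempty
  · have hw' : CNF.IsWidthEq 3 (finCNF ψ hne) := isWidthEq_renameCNF _ hw
    have h := permanent_M3_fin (finCNF ψ hne) hw' (finCNF_occ ψ hw hne)
    rw [card_sat_finCNF] at h
    unfold finCNF at h
    rw [M3_renameCNF _ _ (rk_hf ψ hne), cnfDim_renameCNF, length_renameCNF, cnfDim_eq ψ hw] at h
    exact h
  · have h0 := eq_nil_of_vars_empty ψ hw hne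
    subst h0
    simp [CNF.numSat_nil, Matrix.permanent]

end Nat

end Valiant3CNF

end Literature.Computability.AlgebraicComplexity
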